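import Summits.QuantumFields.YangMills.Theorems.TwistedTraceScaling.Negative.CmpTwoLoopIffUniformOfBase
import Summits.QuantumFields.YangMills.Theorems.LuscherReductionTwistedTraceScalingTowerE1
import Summits.QuantumFields.YangMills.Theorems.LuscherReductionTwistedTraceScalingOfFemtoTraceLaw
import HarnessLib

/-!
# Crux-idea sketch «time-exact-compression», addendum g2: the SANDWICH re-cut CMP-SW of the XL stub CMP-2LOOP
# (ideator #1, gen 2) — stmt-QuantumFields-20203 `LuscherReduction.TwistedTraceScaling`, skeleton «twolattice» REV 3, sha16 1a2ae9b1ae61a9c5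

HONEST FRAMING: stub-level ideation on a child of a CONDITIONAL reduction route (femto rung R2b1 of `LuscherReduction`); nothing here is a
mass gap, infinite volume or Clay; no registry write, no skeleton edit; CMP-2LOOP, UFTL and S-BASE remain OPEN.  This file types ONE statement and
kernel-checks its logical position; it refutes nothing.

THE POINT.  The owner (ym-beyond-p1 g29) names as the hardest module of the XL stub `TwoLattice.Stmt.stub_cmpTwoLoop` (CMP-2LOOP) the
representation step W-REP "on `L³×T` with the irregular UV layer and a time extent `T` NOT divisible by the block factors".  The disprover
(`…Negative.R3`, p551232) showed that MODULO S-BASE the stub is the uniform femto trace law UFTL and that its free time extent, its coupling band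
and its calibrator are absorbed by TRACK + monotonicity of `r(L,β,·)` + continuity of `r_𝔥`.  This addendum turns that reading into a TARGET the
RG prover can aim at WITHOUT S-BASE-type knowledge of the base lattice, by moving every rounding to the side that owns a monotonicity theorem:

  `Stmt.cmpSandwich` (CMP-SW) = the text of `Stmt.stub_cmpTwoLoop` with three freedoms handed to the prover —
  (F1) the calibrator is CHOSEN (`∃ φ`, lawful), not suffered (`∀ φ`);
  (F2) the base coupling `β₁ ≥ 1` in the calibrated band is CHOSEN (`∃ β₁`, after `∀ T`), e.g. `β₁ = x̂/2` exactly, for which the base clock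
       `λ(β₁,b)` IS the calibrated clock `calLambda φ β (k+1) b` by definition;
  (F3) the conclusion is a ONE-SIDED SANDWICH by base trace ratios at two FLOATING coarse times `n₁, n₂` pinned to femto time `s` only within a
       user-named band `η` (`|nᵢ·λ(β₁,b)/b − s| ≤ η`): `r(b,β₁,n₁) − ε ≤ r(L,β,T) ≤ r(b,β₁,n₂) + ε`.
  Nothing else changes (same `M`-tower binders, same window, same `1/(4lam³) ≤ x̂`, same calibrated time clause `|T·calΛ/L − s| ≤ δ`).

WHY (F3) IS THE RIGHT CURRENCY FOR «T NOT BLOCK-DIVISIBLE».  A sandwich is closed under BOTH roundings the RG produces: on the fine side,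
`sandwich_of_neighbours` — a lower bound proved at any representable `T₋ ≤ T` and an upper bound at any representable `T₊ ≥ T` give the sandwich at
`T` (tree `traceRatio_mono`, no S-BASE, no base-lattice continuity); on the coarse side the blocked time `≈ T·b/L` is not an integer and the E1
layer of sides `M`/`M+1` makes the blocked lattice `(1 ± 1/M)`-anisotropic — after renormalisation a common rescaling of coarse time, which is what
two floating times `n₁ ≠ n₂` give ROOM for (room, not a proof: the anisotropic-to-isotropic comparison stays inside W-CMP).  So the prover never
needs `r(b,β₁,·)` to be slowly varying in time or coupling (that IS S-BASE's content); the user (this file) pays for it with S-BASE, once.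
The intermediate CALIBRATOR-ONLY form `Stmt.cmpCalibrated` (CMP-CAL: `β₁ = x̂/2` fixed, so the base clock is `calLambda` itself and no `β₁`
quantifier remains) sits between: CMP-2LOOP ⇒ CMP-CAL ⇒ CMP-SW outright.

KERNEL-CHECKED POSITION (all `sorry`-free):
* `cmpCalibrated_of_cmpTwoLoop`, `cmpSandwich_of_cmpCalibrated`, `cmpSandwich_of_cmpTwoLoop` : CMP-2LOOP ⇒ CMP-CAL ⇒ CMP-SW OUTRIGHT
  (no S-BASE): both re-cuts are weakenings of the registered text;
* `uniform_of_cmpSandwich_of_base` : CMP-SW ∧ S-BASE ⇒ UFTL (E1 landing, matched label, TRACK (i)+(iii) at the prover's calibrator, the sandwich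
  at `T = femtoSteps s β L`, the `η`-band ⇒ `femtoSteps((1−η)s) β₁ b ≤ nᵢ ≤ femtoSteps((1+η)s) β₁ b`, monotonicity ON THE BASE, S-BASE at `(1∓η)s`
  on the finitely many bases `b < M²`, continuity of `r_𝔥`);
* `cmpTwoLoop_of_cmpSandwich_of_base` : CMP-SW ∧ S-BASE ⇒ CMP-2LOOP verbatim (through the disprover's `R3.cmpTwoLoop_of_uniform_of_base`), hence
  `cmpSandwich_iff_cmpTwoLoop_of_base` : MODULO S-BASE, CMP-SW ⟺ CMP-2LOOP (strength-neutral re-cut);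
* `twistedTraceScaling_of_cmpSandwich_of_base` : CMP-SW ∧ S-BASE ⇒ the crux BY NAME (tree `Tower.twistedTraceScaling_of_uniform`).

Disproof used (Cruxes/TwistedTraceScaling/Disproof.lean rev 5): `1 ≤ β₁` kept in (F2) (honours `tower_false_without_beta1GeOne_of_base`), the
window guard `1 ≤ β` is what licenses `traceRatio_mono` on the fine side, `0 < ε` / thresholds untouched (`false_without_epsPos`,
`base_false_without_threshold`), `2 ≤ M` kept; §F clock rigidity is respected — the floating times are pinned to the SAME femto clock within `η`,
not to a competitor clock.  [cite: Luscher1983, §3] [cite: Balaban1989LargeFieldII, pp. 355–6] [cite: MontvayMunster1994, (3.145)]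
-/

set_option autoImplicit false

noncomputable section

open MeasureTheory Filter Topology Real
open Literature.MathematicalPhysics.QuantumFieldTheory hiding SU2
open Literature.MathematicalPhysics.QuantumFieldTheory.Balaban1983to89
open scoped BigOperators

namespace Summit.QuantumFields.YangMills.Cruxes.TwistedTraceScaling.Ideas.TimeExactCompression.Sandwich

open Summit.QuantumFields.YangMills.Theorems.FemtoTransferGap
open Summit.QuantumFields.YangMills.Theorems.FemtoTransferGap.TraceDoor
open Summit.QuantumFields.YangMills.Theorems.FemtoTransferGap.TwoLattice
open Summit.QuantumFields.YangMills.Theorems.TwistedTraceScaling.Negative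
open Summit.QuantumFields.YangMills.Theses.LuscherReduction (TwistedTraceScaling)

/-! ## §1 The statement CMP-SW -/

/-- ★ **CMP-SW — the sandwich re-cut of CMP-2LOOP.**  VERBATIM the binders of `TwoLattice.Stmt.stub_cmpTwoLoop` up to the calibrated time
clause, with: a user band `η > 0` (third universal), the calibrator CHOSEN (`∃ φ`), the base coupling CHOSEN after `T` (`∃ β₁ ≥ 1` in the
calibrated band), and a one-sided sandwich by base trace ratios at two floating coarse times in the `η`-band of the base femto clock.
[cite: Luscher1983, §3] [cite: Balaban1989LargeFieldII, pp. 355–6] -/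
abbrev Stmt.cmpSandwich : Prop :=
  ∀ s : ℝ, 0 < s → ∀ ε : ℝ, 0 < ε → ∀ η : ℝ, 0 < η → ∃ M : ℕ, 2 ≤ M ∧ ∃ δ : ℝ, 0 < δ ∧
    ∃ φ : FlowStep.HBeta, Stmt.twoLoopLawH (B12Normalization.stepBal 2 M) (twoLoopStepBal M) φ ∧
      ∃ lam0 : ℝ, 0 < lam0 ∧ ∀ lam : ℝ, 0 < lam → lam ≤ lam0 →
        ∀ (L : ℕ) [NeZero L], M ^ 2 ≤ L → ∀ β : ℝ, InFemtoWindow lam β L →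
          ∀ (b k : ℕ) [NeZero b], M ≤ b → b < M ^ 2 → b * M ^ (k + 1) ≤ L → L < b * M ^ k * (M + 1) →
            1 / (4 * lam ^ 3) ≤ flowInvSq φ β (k + 1) →
              ∀ T : ℕ, |(T : ℝ) * calLambda φ β (k + 1) b / L - s| ≤ δ →
                ∃ β₁ : ℝ, 1 ≤ β₁ ∧ |flowInvSq φ β (k + 1) - 2 * β₁| ≤ δ * (2 * β₁) ∧
                  ∃ n₁ n₂ : ℕ, |(n₁ : ℝ) * luscherLambda β₁ b / b - s| ≤ η ∧ |(n₂ : ℝ) * luscherLambda β₁ b / b - s| ≤ η ∧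
                    traceRatio b β₁ n₁ - ε ≤ traceRatio L β T ∧ traceRatio L β T ≤ traceRatio b β₁ n₂ + ε

/-- **CMP-CAL — the calibrator-only form** (between CMP-2LOOP and CMP-SW): the base coupling is the calibrated one, `β₁ = x̂/2` with
`x̂ = flowInvSq φ β (k+1)`, so the base femto clock `λ(x̂/2, b)` is `calLambda φ β (k+1) b` by definition and the floating coarse times are pinned by
calibrated data only: `|nᵢ·calΛ/b − s| ≤ η`.  No `β₁` quantifier, no band. [cite: Balaban1989LargeFieldII, pp. 355–6] -/
abbrev Stmt.cmpCalibrated : Prop :=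
  ∀ s : ℝ, 0 < s → ∀ ε : ℝ, 0 < ε → ∀ η : ℝ, 0 < η → ∃ M : ℕ, 2 ≤ M ∧ ∃ δ : ℝ, 0 < δ ∧
    ∃ φ : FlowStep.HBeta, Stmt.twoLoopLawH (B12Normalization.stepBal 2 M) (twoLoopStepBal M) φ ∧
      ∃ lam0 : ℝ, 0 < lam0 ∧ ∀ lam : ℝ, 0 < lam → lam ≤ lam0 →
        ∀ (L : ℕ) [NeZero L], M ^ 2 ≤ L → ∀ β : ℝ, InFemtoWindow lam β L →
          ∀ (b k : ℕ) [NeZero b], M ≤ b → b < M ^ 2 → b * M ^ (k + 1) ≤ L → L < b * M ^ k * (M + 1) →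
            1 / (4 * lam ^ 3) ≤ flowInvSq φ β (k + 1) →
              ∀ T : ℕ, |(T : ℝ) * calLambda φ β (k + 1) b / L - s| ≤ δ →
                ∃ n₁ n₂ : ℕ, |(n₁ : ℝ) * calLambda φ β (k + 1) b / b - s| ≤ η ∧ |(n₂ : ℝ) * calLambda φ β (k + 1) b / b - s| ≤ η ∧
                  traceRatio b (flowInvSq φ β (k + 1) / 2) n₁ - ε ≤ traceRatio L β T ∧
                    traceRatio L β T ≤ traceRatio b (flowInvSq φ β (k + 1) / 2) n₂ + ε

/-! ## §2 The fine-side closure: representable neighbours suffice (no S-BASE) -/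

/-- **Representable neighbours suffice.**  A lower bound for the fine trace ratio at some `T₋ ≤ T` and an upper bound at some `T₊ ≥ T`
(`2 ≤ T₋`, `β ≥ 1`) give both bounds at `T` — the dyadic trace ratio is non-decreasing in the number of steps (tree `traceRatio_mono`).  This is
the whole content of «`T` not divisible by the block factors» on the FINE side. [folklore] -/
theorem sandwich_of_neighbours (L : ℕ) [NeZero L] {β : ℝ} (hβ : 1 ≤ β) {Tlo T Thi : ℕ} (h2 : 2 ≤ Tlo) (hlo : Tlo ≤ T) (hhi : T ≤ Thi)
    {lo hi : ℝ} (hl : lo ≤ traceRatio L β Tlo) (hh : traceRatio L β Thi ≤ hi) :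
    lo ≤ traceRatio L β T ∧ traceRatio L β T ≤ hi :=
  ⟨hl.trans (traceRatio_mono L hβ h2 hlo), (traceRatio_mono L hβ (h2.trans hlo) hhi).trans hh⟩

/-! ## §3 CMP-2LOOP ⇒ CMP-CAL ⇒ CMP-SW outright -/

/-- In a window of depth `lam ≤ 1/2`, a calibrator value `x̂ ≥ 1/(4lam³)` has `x̂/2 ≥ 1`. [folklore] -/
theorem one_le_half_of_calibrated {lam x : ℝ} (hlam : 0 < lam) (hhalf : lam ≤ 1 / 2) (hx : 1 / (4 * lam ^ 3) ≤ x) : 1 ≤ x / 2 := by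
  have hl3 : lam ^ 3 ≤ (1 / 2) ^ 3 := pow_le_pow_left₀ hlam.le hhalf 3
  have h2 : (2 : ℝ) ≤ 1 / (4 * lam ^ 3) := by
    rw [le_div_iff₀ (by positivity)]
    nlinarith
  linarith

/-- ★ **CMP-2LOOP ⇒ CMP-CAL** (no S-BASE): take CMP's `M, δ`, the Markov calibrator (`R3.exists_twoLoopLawH`), `β₁ := x̂/2` (band width `0`,
`≥ 1` for `lam ≤ 1/2`, and `≥` the window thresholds of the finitely many bases `b < M²` by `R3.beta1_ge_of_calibrated`, so that the base femto unit
is `≤ η`), and `n₁ = n₂ := femtoSteps s (x̂/2) b` (in the `η`-band by `Base.femtoSteps_mul_unit`; its clock is `calLambda` by `rfl`). [folklore] -/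
theorem cmpCalibrated_of_cmpTwoLoop (hC : Stmt.stub_cmpTwoLoop) : Stmt.cmpCalibrated := by
  intro s hs ε hε η hη
  obtain ⟨M, hM, δ, hδ, hcmp⟩ := hC s hs ε hε
  obtain ⟨φ, hφ⟩ := R3.exists_twoLoopLawH hM
  obtain ⟨lam0, hlam0, hc⟩ := hcmp φ hφ
  -- window thresholds of depth `≤ η/2` on every base (stated for every `b`, vacuous at `b = 0`), and their finite max
  have hB : ∀ b : ℕ, ∃ βw : ℝ, ∀ (hb : NeZero b) (β : ℝ), βw ≤ β →
      ∃ lam' : ℝ, 0 < lam' ∧ lam' ≤ η / 2 ∧ InFemtoWindow lam' β b := by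
    intro b
    by_cases hb0 : b = 0
    · exact ⟨0, fun hb => absurd hb0 hb.ne⟩
    · haveI : NeZero b := ⟨hb0⟩
      obtain ⟨βw, h⟩ := Base.exists_window_of_large_beta b (lam0 := η / 2) (by positivity)
      exact ⟨βw, fun _ β hβ => h β hβ⟩
  choose βw hβw using hB
  set βstar : ℝ := ∑ b ∈ Finset.range (M ^ 2), max (βw b) 0 with hβstar
  have hβwle : ∀ b : ℕ, b < M ^ 2 → βw b ≤ βstar := fun b hb =>
    (le_max_left _ _).trans
      (Finset.single_le_sum (f := fun b => max (βw b) 0) (fun i _ => le_max_right _ _) (Finset.mem_range.mpr hb))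
  set Bst : ℝ := max βstar 1 with hBst
  have hBst1 : 1 ≤ Bst := le_max_right _ _
  have hBpos : 0 < Bst := lt_of_lt_of_le one_pos hBst1
  refine ⟨M, hM, δ, hδ, φ, hφ, min (min lam0 (1 / 2)) (1 / (8 * (1 + δ) * Bst)),
    lt_min (lt_min hlam0 (by norm_num)) (by positivity), ?_⟩
  intro lam hlam hle L _ hL β hW b k _ hMb hbM hkL hLk hx T hT
  have hl0 : lam ≤ lam0 := hle.trans ((min_le_left _ _).trans (min_le_left _ _))
  have hlhalf : lam ≤ 1 / 2 := hle.trans ((min_le_left _ _).trans (min_le_right _ _))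
  have hlB : lam ≤ 1 / (8 * (1 + δ) * Bst) := hle.trans (min_le_right _ _)
  have hlone : lam ≤ 1 := by linarith
  -- the calibrated base coupling `x̂/2`
  have hβ₁1 : 1 ≤ flowInvSq φ β (k + 1) / 2 := one_le_half_of_calibrated hlam hlhalf hx
  have hband : |flowInvSq φ β (k + 1) - 2 * (flowInvSq φ β (k + 1) / 2)| ≤ δ * (2 * (flowInvSq φ β (k + 1) / 2)) := by
    rw [show flowInvSq φ β (k + 1) - 2 * (flowInvSq φ β (k + 1) / 2) = 0 by ring, abs_zero]
    exact mul_nonneg hδ.le (by linarith)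
  have hβ₁B : Bst ≤ flowInvSq φ β (k + 1) / 2 := R3.beta1_ge_of_calibrated hlam hlone hδ hBpos hlB hx hband
  obtain ⟨lam', hlam', hlam'le, hW₁⟩ :=
    hβw b ‹NeZero b› (flowInvSq φ β (k + 1) / 2) (((hβwle b hbM).trans (le_max_left _ _)).trans hβ₁B)
  -- the coarse time `femtoSteps s (x̂/2) b` lies in the `η`-band of the calibrated clock (`calLambda = λ(x̂/2, b)` by `rfl`)
  obtain ⟨hF1, hF2⟩ := Base.femtoSteps_mul_unit hs.le hlam' hW₁
  have hu1 : luscherLambda (flowInvSq φ β (k + 1) / 2) b / b ≤ 2 * lam' := Base.unit_le_of_window hlam' hW₁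
  have hbandT : |(femtoSteps s (flowInvSq φ β (k + 1) / 2) b : ℝ) * calLambda φ β (k + 1) b / b - s| ≤ η := by
    show |(femtoSteps s (flowInvSq φ β (k + 1) / 2) b : ℝ) * luscherLambda (flowInvSq φ β (k + 1) / 2) b / b - s| ≤ η
    rw [mul_div_assoc, abs_le]
    constructor <;> linarith
  have hcmpT := hc lam hlam hl0 L hL β hW b k hMb hbM hkL hLk hx (flowInvSq φ β (k + 1) / 2) hβ₁1 hband T hT
  obtain ⟨h1, h2⟩ := abs_le.mp hcmpT
  exact ⟨femtoSteps s (flowInvSq φ β (k + 1) / 2) b, femtoSteps s (flowInvSq φ β (k + 1) / 2) b, hbandT, hbandT,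
    by linarith, by linarith⟩

/-- **CMP-CAL ⇒ CMP-SW** (no S-BASE): `β₁ := x̂/2` (`≥ 1` once `lam ≤ 1/2`; band width `0`); the clocks agree by `rfl`. [folklore] -/
theorem cmpSandwich_of_cmpCalibrated (hK : Stmt.cmpCalibrated) : Stmt.cmpSandwich := by
  intro s hs ε hε η hη
  obtain ⟨M, hM, δ, hδ, φ, hφ, lam0, hlam0, hc⟩ := hK s hs ε hε η hη
  refine ⟨M, hM, δ, hδ, φ, hφ, min lam0 (1 / 2), lt_min hlam0 (by norm_num), ?_⟩
  intro lam hlam hle L _ hL β hW b k _ hMb hbM hkL hLk hx T hT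
  obtain ⟨n₁, n₂, hn₁, hn₂, hlow, hupp⟩ :=
    hc lam hlam (hle.trans (min_le_left _ _)) L hL β hW b k hMb hbM hkL hLk hx T hT
  have hβ₁1 : 1 ≤ flowInvSq φ β (k + 1) / 2 := one_le_half_of_calibrated hlam (hle.trans (min_le_right _ _)) hx
  have hband : |flowInvSq φ β (k + 1) - 2 * (flowInvSq φ β (k + 1) / 2)| ≤ δ * (2 * (flowInvSq φ β (k + 1) / 2)) := by
    rw [show flowInvSq φ β (k + 1) - 2 * (flowInvSq φ β (k + 1) / 2) = 0 by ring, abs_zero]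
    exact mul_nonneg hδ.le (by linarith)
  exact ⟨flowInvSq φ β (k + 1) / 2, hβ₁1, hband, n₁, n₂, hn₁, hn₂, hlow, hupp⟩

/-- ★ **CMP-2LOOP ⇒ CMP-SW** (no S-BASE): the sandwich re-cut is a weakening of the registered XL text. [folklore] -/
theorem cmpSandwich_of_cmpTwoLoop (hC : Stmt.stub_cmpTwoLoop) : Stmt.cmpSandwich :=
  cmpSandwich_of_cmpCalibrated (cmpCalibrated_of_cmpTwoLoop hC)

/-! ## §4 ★ CMP-SW ∧ S-BASE ⇒ UFTL ⇒ CMP-2LOOP, and the crux by name -/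

set_option maxHeartbeats 800000 in
/-- ★ **CMP-SW ∧ S-BASE ⇒ UFTL** (the `lam`-uniform femto trace law, threshold `M²`).  Given `(s, ε)`: `η ≤ 1/2` from the continuity of `r_𝔥` at
`s` (`ε/4`); CMP-SW at `(s, ε/4, ηs)` gives `M, δ`, a lawful calibrator `φ` and a depth; TRACK (tree `TwoLattice.stub_labelTracking`) at that
calibrator gives, at the label-matched `β₁' ≥ 1` on the landing base `b` (`Tower.exists_tower_landing`, `Tower.exists_matched`), the window
clause `1/(4lam³) ≤ x̂` and the calibrated time clause for `T = femtoSteps s β L`; the sandwich returns `β₁ ≥ 1` in the band — hence `≥` every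
base threshold (`R3.beta1_ge_of_calibrated`) — and `n₁, n₂` in the `ηs`-band, which puts `femtoSteps((1−η)s) β₁ b ≤ nᵢ ≤ femtoSteps((1+η)s) β₁ b`
(base femto unit `≤ s/4` beyond the window threshold); monotonicity ON THE BASE (`traceRatio_mono b`), S-BASE at `(1∓η)s` (finite max of thresholds
over `b < M²`) and continuity of `r_𝔥` put `r(b,β₁,nᵢ)` within `ε/2` of `r_𝔥(s)`, and the sandwich puts `r(L,β,femtoSteps s β L)` within `3ε/4`.
[cite: Luscher1983, §3] [cite: MontvayMunster1994, (3.145)] -/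
theorem uniform_of_cmpSandwich_of_base (hS : Stmt.cmpSandwich)
    (hBASE : ∀ (L1 : ℕ) [NeZero L1] (s : ℝ), 0 < s → ∀ ε : ℝ, 0 < ε → ∃ β1 : ℝ, ∀ β : ℝ, β1 ≤ β →
      |traceRatio L1 β (femtoSteps s β L1) - hTraceRatio s| ≤ ε) :
    ∀ s : ℝ, 0 < s → ∀ ε : ℝ, 0 < ε → ∃ L0 : ℕ, ∃ lam0 : ℝ, 0 < lam0 ∧ ∀ lam : ℝ, 0 < lam → lam ≤ lam0 →
      ∀ (L : ℕ) [NeZero L], L0 ≤ L → ∀ β : ℝ, InFemtoWindow lam β L →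
        |traceRatio L β (femtoSteps s β L) - hTraceRatio s| ≤ ε := by
  intro s hs ε hε
  -- continuity of the target at `s`: a relative time shift `η ≤ 1/2` with `r_𝔥((1∓η)s)` within `ε/4` of `r_𝔥(s)`
  obtain ⟨δc, hδc, hcont⟩ := Metric.continuousAt_iff.mp (continuousAt_hTraceRatio hs) (ε / 4) (by positivity)
  obtain ⟨η, hη0, hη2, hηs⟩ : ∃ η : ℝ, 0 < η ∧ η ≤ 1 / 2 ∧ η * s < δc := by
    refine ⟨min (δc / (2 * s)) (1 / 2), by positivity, min_le_right _ _, ?_⟩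
    calc min (δc / (2 * s)) (1 / 2) * s ≤ δc / (2 * s) * s := mul_le_mul_of_nonneg_right (min_le_left _ _) hs.le
      _ = δc / 2 := by field_simp
      _ < δc := by linarith
  have hs1 : 0 < (1 - η) * s := by nlinarith
  have hs2 : 0 < (1 + η) * s := by positivity
  have hr1 : |hTraceRatio ((1 - η) * s) - hTraceRatio s| < ε / 4 := by
    have h := hcont (x := (1 - η) * s)
      (by rw [Real.dist_eq, show (1 - η) * s - s = -(η * s) by ring, abs_neg, abs_of_pos (by positivity)]; exact hηs)
    rwa [Real.dist_eq] at h
  have hr2 : |hTraceRatio ((1 + η) * s) - hTraceRatio s| < ε / 4 := by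
    have h := hcont (x := (1 + η) * s)
      (by rw [Real.dist_eq, show (1 + η) * s - s = η * s by ring, abs_of_pos (by positivity)]; exact hηs)
    rwa [Real.dist_eq] at h
  -- CMP-SW at `(s, ε/4, ηs)`: block factor, tolerance, a lawful calibrator and a depth
  obtain ⟨M, hM, δ, hδ, φ, hφ, lam0, hlam0, hc⟩ := hS s hs (ε / 4) (by positivity) (η * s) (by positivity)
  -- TRACK for this calibrator
  obtain ⟨lam1, hlam1, H1⟩ := TwoLattice.stub_labelTracking M hM δ hδ s hs φ hφ
  -- base thresholds: S-BASE at `(1∓η)s` with `ε/4` and a window of depth `≤ s/8`, on every base (vacuous at `b = 0`)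
  have hB : ∀ b : ℕ, ∃ β1 : ℝ, ∀ (hb : NeZero b) (β : ℝ), β1 ≤ β →
      |traceRatio b β (femtoSteps ((1 - η) * s) β b) - hTraceRatio ((1 - η) * s)| ≤ ε / 4 ∧
      |traceRatio b β (femtoSteps ((1 + η) * s) β b) - hTraceRatio ((1 + η) * s)| ≤ ε / 4 ∧
      ∃ lam' : ℝ, 0 < lam' ∧ lam' ≤ s / 8 ∧ InFemtoWindow lam' β b := by
    intro b
    by_cases hb0 : b = 0
    · exact ⟨0, fun hb => absurd hb0 hb.ne⟩
    · haveI : NeZero b := ⟨hb0⟩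
      obtain ⟨βa, ha⟩ := hBASE b ((1 - η) * s) hs1 (ε / 4) (by positivity)
      obtain ⟨βb, hb⟩ := hBASE b ((1 + η) * s) hs2 (ε / 4) (by positivity)
      obtain ⟨βw, hw⟩ := Base.exists_window_of_large_beta b (lam0 := s / 8) (by positivity)
      exact ⟨max βa (max βb βw), fun _ β hβ =>
        ⟨ha β ((le_max_left _ _).trans hβ), hb β (((le_max_left _ _).trans (le_max_right _ _)).trans hβ),
          hw β (((le_max_right _ _).trans (le_max_right _ _)).trans hβ)⟩⟩
  choose β1 hβ1 using hB
  set βstar : ℝ := ∑ b ∈ Finset.range (M ^ 2), max (β1 b) 0 with hβstar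
  have hβ1le : ∀ b : ℕ, b < M ^ 2 → β1 b ≤ βstar := fun b hb =>
    (le_max_left _ _).trans
      (Finset.single_le_sum (f := fun b => max (β1 b) 0) (fun i _ => le_max_right _ _) (Finset.mem_range.mpr hb))
  set Bst : ℝ := max βstar 1 with hBst
  have hBst1 : 1 ≤ Bst := le_max_right _ _
  have hBpos : 0 < Bst := lt_of_lt_of_le one_pos hBst1
  -- the depth
  refine ⟨M ^ 2, min (min lam0 lam1) (min (1 / 2) (1 / (8 * (1 + δ) * Bst))),
    lt_min (lt_min hlam0 hlam1) (lt_min (by norm_num) (by positivity)), ?_⟩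
  intro lam hlam hle L _ hL β hW
  have hl0 : lam ≤ lam0 := hle.trans ((min_le_left _ _).trans (min_le_left _ _))
  have hl1 : lam ≤ lam1 := hle.trans ((min_le_left _ _).trans (min_le_right _ _))
  have hlhalf : lam ≤ 1 / 2 := hle.trans ((min_le_right _ _).trans (min_le_left _ _))
  have hlB : lam ≤ 1 / (8 * (1 + δ) * Bst) := hle.trans ((min_le_right _ _).trans (min_le_right _ _))
  have hlone : lam ≤ 1 := by linarith
  -- E1 landing, a label-matched base coupling, TRACK (i) and (iii) at it
  obtain ⟨k, b, hMb, hbM2, hbL, hLb⟩ := Tower.exists_tower_landing hM hL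
  haveI hb : NeZero b := ⟨by omega⟩
  obtain ⟨β₁', hβ₁'1, hmatch⟩ :=
    Tower.exists_matched b (v := invRunningCoupling β L) (Tower.one_le_invRunningCoupling_of_window hlam hlhalf hW)
  obtain ⟨hx, -, hiii⟩ := H1 lam hlam hl1 L hL β hW b k hMb hbM2 hbL hLb β₁' hβ₁'1 hmatch
  -- the sandwich at `T = femtoSteps s β L`
  obtain ⟨β₁, hβ₁1, hband, n₁, n₂, hn₁, hn₂, hlow, hupp⟩ :=
    hc lam hlam hl0 L hL β hW b k hMb hbM2 hbL hLb hx (femtoSteps s β L) hiii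
  -- `β₁` clears every base threshold
  have hβ₁B : Bst ≤ β₁ := R3.beta1_ge_of_calibrated hlam hlone hδ hBpos hlB hx hband
  obtain ⟨hSa, hSb, lam', hlam', hlam'le, hW₁⟩ := hβ1 b hb β₁ (((hβ1le b hbM2).trans (le_max_left _ _)).trans hβ₁B)
  -- the base femto unit `u₁ = λ(β₁,b)/b ∈ (0, s/4]`
  have hb0 : (0 : ℝ) < (b : ℝ) := by exact_mod_cast Nat.pos_of_ne_zero (NeZero.ne b)
  have hl₁ : 0 < luscherLambda β₁ b := luscherLambda_pos_of_window hlam' hW₁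
  set u₁ : ℝ := luscherLambda β₁ b / b with hu₁_def
  have hu₁ : 0 < u₁ := Base.unit_pos_of_window hlam' hW₁
  have hu₁le : u₁ ≤ s / 4 := (Base.unit_le_of_window hlam' hW₁).trans (by linarith)
  have e_div : ∀ x : ℝ, x * b / luscherLambda β₁ b = x / u₁ := by
    intro x; rw [hu₁_def]; field_simp
  -- the `ηs`-band puts a coarse time between the base femto counts at `(1∓η)s`
  have key : ∀ n : ℕ, |(n : ℝ) * luscherLambda β₁ b / b - s| ≤ η * s →
      femtoSteps ((1 - η) * s) β₁ b ≤ n ∧ n ≤ femtoSteps ((1 + η) * s) β₁ b := by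
    intro n hn
    rw [mul_div_assoc] at hn
    obtain ⟨h1, h2⟩ := abs_le.mp hn
    constructor
    · unfold femtoSteps
      refine Nat.ceil_le.mpr ?_
      rw [e_div, div_le_iff₀ hu₁]
      linarith
    · have h3 : (n : ℝ) ≤ (1 + η) * s * b / luscherLambda β₁ b := by
        rw [e_div, le_div_iff₀ hu₁]
        linarith
      unfold femtoSteps
      exact_mod_cast h3.trans (Nat.le_ceil _)
  have h2 : 2 ≤ femtoSteps ((1 - η) * s) β₁ b := by
    have h1 : (1 : ℝ) < (1 - η) * s * b / luscherLambda β₁ b := by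
      rw [e_div, lt_div_iff₀ hu₁]
      nlinarith
    have h3 : 1 < femtoSteps ((1 - η) * s) β₁ b := by
      unfold femtoSteps
      exact Nat.lt_ceil.mpr (by exact_mod_cast h1)
    omega
  obtain ⟨hlo1, hhi1⟩ := key n₁ hn₁
  obtain ⟨hlo2, hhi2⟩ := key n₂ hn₂
  -- monotonicity on the base lattice
  have m1 : traceRatio b β₁ (femtoSteps ((1 - η) * s) β₁ b) ≤ traceRatio b β₁ n₁ := traceRatio_mono b hβ₁1 h2 hlo1
  have m2 : traceRatio b β₁ n₂ ≤ traceRatio b β₁ (femtoSteps ((1 + η) * s) β₁ b) :=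
    traceRatio_mono b hβ₁1 (h2.trans hlo2) hhi2
  have eA := abs_le.mp hSa
  have eB := abs_le.mp hSb
  have f1 := abs_lt.mp hr1
  have f2 := abs_lt.mp hr2
  rw [abs_le]
  constructor <;> linarith

/-- ★ **CMP-SW ∧ S-BASE ⇒ CMP-2LOOP verbatim** (the registered XL text `TwoLattice.Stmt.stub_cmpTwoLoop`, for EVERY lawful calibrator), through UFTL
and the disprover's `R3.cmpTwoLoop_of_uniform_of_base`. [folklore] -/
theorem cmpTwoLoop_of_cmpSandwich_of_base (hS : Stmt.cmpSandwich)
    (hBASE : ∀ (L1 : ℕ) [NeZero L1] (s : ℝ), 0 < s → ∀ ε : ℝ, 0 < ε → ∃ β1 : ℝ, ∀ β : ℝ, β1 ≤ β →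
      |traceRatio L1 β (femtoSteps s β L1) - hTraceRatio s| ≤ ε) :
    Stmt.stub_cmpTwoLoop :=
  R3.cmpTwoLoop_of_uniform_of_base (uniform_of_cmpSandwich_of_base hS hBASE) hBASE

/-- ★ **Modulo S-BASE, CMP-SW ⟺ CMP-2LOOP**: the sandwich re-cut is strength-neutral given the fixed-lattice law (`←` needs no S-BASE). [folklore] -/
theorem cmpSandwich_iff_cmpTwoLoop_of_base
    (hBASE : ∀ (L1 : ℕ) [NeZero L1] (s : ℝ), 0 < s → ∀ ε : ℝ, 0 < ε → ∃ β1 : ℝ, ∀ β : ℝ, β1 ≤ β →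
      |traceRatio L1 β (femtoSteps s β L1) - hTraceRatio s| ≤ ε) :
    Stmt.cmpSandwich ↔ Stmt.stub_cmpTwoLoop :=
  ⟨fun hS => cmpTwoLoop_of_cmpSandwich_of_base hS hBASE, fun hC => cmpSandwich_of_cmpTwoLoop hC⟩

/-- ★ **CMP-SW ∧ S-BASE ⇒ the crux `TwistedTraceScaling` BY NAME** (tree `Tower.twistedTraceScaling_of_uniform`; S-OSTL is closed in the tree).
[cite: Luscher1983, §3] -/
theorem twistedTraceScaling_of_cmpSandwich_of_base (hS : Stmt.cmpSandwich)
    (hBASE : ∀ (L1 : ℕ) [NeZero L1] (s : ℝ), 0 < s → ∀ ε : ℝ, 0 < ε → ∃ β1 : ℝ, ∀ β : ℝ, β1 ≤ β →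
      |traceRatio L1 β (femtoSteps s β L1) - hTraceRatio s| ≤ ε) :
    TwistedTraceScaling :=
  Tower.twistedTraceScaling_of_uniform (uniform_of_cmpSandwich_of_base hS hBASE)

/-- **Modulo S-BASE, CMP-CAL ⟺ CMP-2LOOP** as well (it sits between CMP-2LOOP and CMP-SW). [folklore] -/
theorem cmpCalibrated_iff_cmpTwoLoop_of_base
    (hBASE : ∀ (L1 : ℕ) [NeZero L1] (s : ℝ), 0 < s → ∀ ε : ℝ, 0 < ε → ∃ β1 : ℝ, ∀ β : ℝ, β1 ≤ β →
      |traceRatio L1 β (femtoSteps s β L1) - hTraceRatio s| ≤ ε) :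
    Stmt.cmpCalibrated ↔ Stmt.stub_cmpTwoLoop :=
  ⟨fun hK => cmpTwoLoop_of_cmpSandwich_of_base (cmpSandwich_of_cmpCalibrated hK) hBASE, fun hC => cmpCalibrated_of_cmpTwoLoop hC⟩

end Summit.QuantumFields.YangMills.Cruxes.TwistedTraceScaling.Ideas.TimeExactCompression.Sandwich

end
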